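import Literature.NumberTheory.EllipticCurves.AnticyclotomicSignedSelmer
import Literature.NumberTheory.EllipticCurves.AnticyclotomicSignedSelmerDualMapsProofs
import Literature.NumberTheory.EllipticCurves.Kobayashi2003.SignedSelmerDualExistsProofs
import HarnessLib

/-!
# Stub (a) `stub_xAcTorsionSS` of line `bdpline` (crux `AnticyclotomicEisensteinDivisibility`,
# stmt-BirchSwinnertonDyer-20727) — helper 3: the rank of Kim's/Castella–Wan's dual `X_ε`
# (`AcSigned.X … (fun _ ↦ .sgn ε)`) is the rank of Kobayashi's dual `X^ε(E/K_∞)` once the two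
# transcriptions of the signed Selmer group agree

Width seat bsd-line-sbc-p1-w4 (gen 0), `--supports stmt-BirchSwinnertonDyer-20727`. Given the identity of
carriers `AcSigned.selmer W p κ ∅ (fun _ ↦ .sgn ε) = Kobayashi2003.signedSelmerInfty W κ ε` (sibling files
`…XAcTorsionSignedCarrier{Local,}.lean`), the `Λ`-module `AcSigned.X W p κ ∅ (fun _ ↦ .sgn ε)` (structure
`X.moduleOfGen hγ`, `T = conj_γ − 1`) is LINEARLY ISOMORPHIC to Kobayashi's canonical dual
`(Kobayashi2003.signedSelmerDualData W κ ε hγ).X` (same recipe on the same subgroup; the identity on classes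
intertwines `conj_γ`, `IwasawaDual.IsLocNil.smulFun_comp_eq`), so finite generation and `finrank` transport:
`X.hasRank_sgn_of_signedSelmerDual`. This is what lets the REFEREED rank-one theorem
`AcSigned.longoVigni2019_thm14_signedSelmerDual_rank_one` (stated on `SignedSelmerDualData`) feed the
hypothesis `X.HasRank … (sgn ε) 1` of the torsion transfer (helper 1, `…XAcTorsionTransfer.lean`).
Kernel plumbing; no definition, no named fact; nothing about BSD.

References: [Kobayashi2003] Def. 1.1 (p. 2); [CastellaWan2023] §4.2 (MS p. 22); [GreenbergLNM1716] §1 p. 60.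
-/

-- D-0017: single-problem summit, the namespace repeats the problem name by design.
set_option linter.dupNamespace false
set_option autoImplicit false

noncomputable section

open scoped Classical

universe u

namespace Summit.BirchSwinnertonDyer.BirchSwinnertonDyer.Theorems.SignedBaseChangeAcDivXAcTorsionCarrier

open NumberField IsDedekindDomain Field
open Literature.NumberTheory.EllipticCurves Literature.NumberTheory.GaloisRepresentations WeierstrassCurve
  ZpExtension Literature.NumberTheory.EllipticCurves.Kobayashi2003 Literature.NumberTheory.EllipticCurves.AcSigned

variable {K : Type u} [Field K] [NumberField K] (W : WeierstrassCurve K) (p : ℕ) [Fact p.Prime]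
  (κ : ZpExtension K p) {γ : absoluteGaloisGroup K} (hγ : κ.IsTopGenerator γ) (ε : ℤˣ)

/-- **`X_ε ≃ₗ X^ε(E/K_∞)`**: if Kim's `K_∞`-level signed Selmer group equals Kobayashi's direct limit (as
subgroups of `H¹(K_∞, E[p^∞])`), the two Pontryagin duals with their `T = conj_γ − 1` structures
(`AcSigned.X.moduleOfGen`, `Kobayashi2003.signedSelmerDualData`) are `Λ`-linearly isomorphic (composition
with the identity on classes; linearity by `IwasawaDual.IsLocNil.smulFun_comp_eq`).
[cite: Kobayashi2003, Def. 1.1 (sentence following it, p. 2)] [cite: GreenbergLNM1716, §1 p. 60] -/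
theorem X.exists_linearEquiv_signedSelmerDual
    (heq : AcSigned.selmer W p κ ∅ (fun _ ↦ .sgn ε) = signedSelmerInfty W κ ε) :
    letI := X.moduleOfGen W p κ ∅ (fun _ ↦ .sgn ε) hγ
    Nonempty (X W p κ ∅ (fun _ ↦ .sgn ε) ≃ₗ[IwasawaAlgebra p] (signedSelmerDualData W κ ε hγ).X) := by
  letI iX : Module (IwasawaAlgebra p) (X W p κ ∅ (fun _ ↦ .sgn ε)) :=
    X.moduleOfGen W p κ ∅ (fun _ ↦ .sgn ε) hγ
  -- the two inclusions (identity on classes)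
  let j₁ : signedSelmerInfty W κ ε →+ AcSigned.selmer W p κ ∅ (fun _ ↦ .sgn ε) :=
    AddSubgroup.inclusion heq.ge
  let j₂ : AcSigned.selmer W p κ ∅ (fun _ ↦ .sgn ε) →+ signedSelmerInfty W κ ε :=
    AddSubgroup.inclusion heq.le
  have hj₁₂ : ∀ s, j₁ (j₂ s) = s := fun s ↦ Subtype.ext rfl
  have hj₂₁ : ∀ s, j₂ (j₁ s) = s := fun s ↦ Subtype.ext rfl
  have hj₁ψ : ∀ s, j₁ ((conjSignedSelmerInfty W κ ε γ - 1) s) =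
      (conjSelmer W p κ ∅ (fun _ ↦ .sgn ε) γ - 1) (j₁ s) := fun s ↦ by
    apply Subtype.ext
    simp only [j₁, IwasawaDual.End_sub_apply, AddMonoid.End.one_apply, map_sub,
      AddSubgroup.coe_inclusion, AddSubgroupClass.coe_sub, coe_conjSelmer_apply,
      coe_conjSignedSelmerInfty_apply]
  let e : X W p κ ∅ (fun _ ↦ .sgn ε) ≃ₗ[IwasawaAlgebra p] (signedSelmerDualData W κ ε hγ).X :=
    { toFun := fun x ↦ x.comp j₁
      invFun := fun (y : signedSelmerInfty W κ ε →+ AddCircle (1 : ℚ)) ↦ y.comp j₂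
      map_add' := fun x y ↦ AddMonoidHom.ext fun s ↦ rfl
      map_smul' := fun f x ↦ by
        change ((isLocNil_conjSelmer_sub_one W p κ ∅ (fun _ ↦ PCond.sgn ε) hγ).smulFun f x).comp j₁ =
          (isLocNil_conjSignedSelmerInfty_sub_one W κ ε hγ).smulFun f (x.comp j₁)
        exact (IwasawaDual.IsLocNil.smulFun_comp_eq
          (isLocNil_conjSignedSelmerInfty_sub_one W κ ε hγ)
          (isLocNil_conjSelmer_sub_one W p κ ∅ (fun _ ↦ PCond.sgn ε) hγ) j₁ hj₁ψ f x).symm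
      left_inv := fun x ↦ AddMonoidHom.ext fun s ↦ by change x (j₁ (j₂ s)) = x s; rw [hj₁₂]
      right_inv := fun y ↦ AddMonoidHom.ext fun s ↦ by
        change (show signedSelmerInfty W κ ε →+ AddCircle (1 : ℚ) from y) (j₂ (j₁ s)) =
          (show signedSelmerInfty W κ ε →+ AddCircle (1 : ℚ) from y) s
        rw [hj₂₁] }
  exact ⟨e⟩

/-- **Rank transport**: under the identity of carriers, "`X^ε(E/K_∞)` finitely generated of rank `r`" for
Kobayashi's canonical dual (the conclusion of `longoVigni2019_thm14_signedSelmerDual_rank_one` at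
`D = signedSelmerDualData W κ ε hγ`, `r = 1`) gives `AcSigned.X.HasRank W p κ ∅ (fun _ ↦ .sgn ε) hγ r` — the
input `hX` of the torsion transfer `TransferInputs.isFGTorsion_at_str_rel_of_hasRank`.
[cite: LongoVigni2019, Thm. 1.4] [cite: Kobayashi2003, Def. 1.1] -/
theorem X.hasRank_sgn_of_signedSelmerDual
    (heq : AcSigned.selmer W p κ ∅ (fun _ ↦ .sgn ε) = signedSelmerInfty W κ ε) {r : ℕ}
    (hD : Module.Finite (IwasawaAlgebra p) (signedSelmerDualData W κ ε hγ).X ∧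
      Module.finrank (IwasawaAlgebra p) (signedSelmerDualData W κ ε hγ).X = r) :
    X.HasRank W p κ ∅ (fun _ ↦ .sgn ε) hγ r := by
  letI iX : Module (IwasawaAlgebra p) (X W p κ ∅ (fun _ ↦ .sgn ε)) :=
    X.moduleOfGen W p κ ∅ (fun _ ↦ .sgn ε) hγ
  obtain ⟨e⟩ := X.exists_linearEquiv_signedSelmerDual W p κ hγ ε heq
  haveI := hD.1
  exact ⟨Module.Finite.equiv e.symm, by rw [e.finrank_eq, hD.2]⟩

end Summit.BirchSwinnertonDyer.BirchSwinnertonDyer.Theorems.SignedBaseChangeAcDivXAcTorsionCarrier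

end
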